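import Literature.Probability.RandomPlanarGeometry.SAWSubBallisticSixteenDirPrelim
import Literature.Probability.RandomPlanarGeometry.SAWTiltedFiniteMemory16T21x11x10
import Mathlib.Analysis.Complex.Exponential
import HarnessLib

/-!
# Duminil-Copin–Hammond's sub-ballisticity on `ℤ²` with an explicit rate above speed `0.3935` (sixteen directions)

Topic `Literature/Probability/RandomPlanarGeometry` (continues `SAWSubBallisticEightDirections.lean`, threshold
`speedThreshold8 = 0.4144`, with the preliminaries `SAWSubBallisticSixteenDirPrelim.lean` and the `(2,1)`-tilted
certificate `FiniteMemory.checkT_16_d21_11_10`, growth `≤ 34181244/(1000·110²) = 2.824896`).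
* `card_maxDisplacementEvent_le_sixteen` — `#E ≤ 4·#(axis event) + 4·#(diagonal event) + 8·#((2,1) event)`;
* `card_maxDisplacementEvent_le_exp16` — `#E ≤ 4(n+1)2⁸²(e^{-ε₁ n} + e^{-ε₂ n} + 2e^{-ε₃ n}) cₙ` for all `v ≥ 0`, `n`,
  `ε₁ = 0.9732 v log(11/9) − log(λ̄₁/2.604)`, `ε₂ = 1.3959 v log(7/6) − log(λ̄₂/2.604)`,
  `ε₃ = 2.176 v log(11/10) − log(λ̄₃/2.604)`;
* `speedThreshold16` (`= 0.3933…`), `speedThreshold16_lt : speedThreshold16 < 0.3935`, **`dch_thm11_two_explicit16`**: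
  Theorem 1.1 of Duminil-Copin–Hammond on `ℤ²` in the printed shape for every `v > 0.3935` (previously `0.4144`).
Sources: H. Duminil-Copin, A. Hammond, Commun. Math. Phys. 324 (2013) 401–423, Theorem 1.1 [DuminilCopinHammond2013];
A. Pönitz, P. Tittmann, Electron. J. Combin. 7 (2000) R21, §3 [PonitzTittmann2000].
-/

open Finset Literature.Probability.LatticeModels
open scoped BigOperators

namespace Literature.Probability.RandomPlanarGeometry.SAW

open FiniteMemory

/-! ### The Duminil-Copin–Hammond event through sixteen directions -/

/-- **Sixteen-direction covering of the event**: for `v ≥ 0`, `#(maxDisplacementEvent 2 n v) ≤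
4·#{∃k: x(ω_k) ≥ ⌈0.9732vn⌉} + 4·#{∃k: x+y ≥ ⌈1.3959vn⌉} + 8·#{∃k: 2x+y ≥ ⌈2.176vn⌉}` (the other directional
events are no larger, by the lattice symmetries). [cite: DuminilCopinHammond2013, Thm 1.1] -/
theorem card_maxDisplacementEvent_le_sixteen {v : ℝ} (hv : 0 ≤ v) (n : ℕ) :
    (Zd.maxDisplacementEvent 2 n v).card ≤
      4 * ((sawWords n).filter fun w => ∃ k ≤ n, ⌈9732 / 10000 * (v * n)⌉ ≤ traj w k 0).card +
      4 * ((sawWords n).filter fun w => ∃ k ≤ n, ⌈13959 / 10000 * (v * n)⌉ ≤ traj w k 0 + traj w k 1).card +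
      8 * ((sawWords n).filter fun w => ∃ k ≤ n, ⌈2176 / 1000 * (v * n)⌉ ≤ 2 * traj w k 0 + traj w k 1).card := by
  classical
  set ma : ℤ := ⌈9732 / 10000 * (v * n)⌉ with hma
  set md : ℤ := ⌈13959 / 10000 * (v * n)⌉ with hmd
  set mt : ℤ := ⌈2176 / 1000 * (v * n)⌉ with hmt
  have hword : (Zd.maxDisplacementEvent 2 n v).card =
      ((sawWords n).filter fun w => ∃ k ≤ n, v * n ≤ Zd.euclidNorm (traj w k)).card := by
    rw [Zd.maxDisplacementEvent, ← image_traj_sawWords, filter_image, card_image_of_injOn]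
    · intro w hw w' hw' h
      simp only [coe_filter, Set.mem_setOf_eq, mem_sawWords] at hw hw'
      exact eq_of_traj_eq (by rw [hw.1.1, hw'.1.1]) h
  rw [hword]
  set f21 : Site 2 → ℤ := fun z => 2 * z 0 + z 1 with hf21
  set Ax := (sawWords n).filter fun w => ∃ k ≤ n, ma ≤ traj w k 0 with hAx
  set Anx := (sawWords n).filter fun w => ∃ k ≤ n, ma ≤ negX (traj w k) 0 with hAnx
  set Ay := (sawWords n).filter fun w => ∃ k ≤ n, ma ≤ rotYX (traj w k) 0 with hAy
  set Any := (sawWords n).filter fun w => ∃ k ≤ n, ma ≤ rotNegYX (traj w k) 0 with hAny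
  set Dp := (sawWords n).filter fun w => ∃ k ≤ n, md ≤ traj w k 0 + traj w k 1 with hDp
  set Dm := (sawWords n).filter fun w => ∃ k ≤ n, md ≤ negXY (traj w k) 0 + negXY (traj w k) 1 with hDm
  set Dq := (sawWords n).filter fun w => ∃ k ≤ n, md ≤ negY (traj w k) 0 + negY (traj w k) 1 with hDq
  set Dr := (sawWords n).filter fun w => ∃ k ≤ n, md ≤ negX (traj w k) 0 + negX (traj w k) 1 with hDr
  set T1 := (sawWords n).filter fun w => ∃ k ≤ n, mt ≤ f21 (traj w k) with hT1
  set T2 := (sawWords n).filter fun w => ∃ k ≤ n, mt ≤ f21 (negXY (traj w k)) with hT2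
  set T3 := (sawWords n).filter fun w => ∃ k ≤ n, mt ≤ f21 (negY (traj w k)) with hT3
  set T4 := (sawWords n).filter fun w => ∃ k ≤ n, mt ≤ f21 (negX (traj w k)) with hT4
  set T5 := (sawWords n).filter fun w => ∃ k ≤ n, mt ≤ f21 (rotNegYX (negY (traj w k))) with hT5
  set T6 := (sawWords n).filter fun w => ∃ k ≤ n, mt ≤ f21 (rotYX (negY (traj w k))) with hT6
  set T7 := (sawWords n).filter fun w => ∃ k ≤ n, mt ≤ f21 (rotNegYX (traj w k)) with hT7
  set T8 := (sawWords n).filter fun w => ∃ k ≤ n, mt ≤ f21 (rotYX (traj w k)) with hT8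
  have hsub : ((sawWords n).filter fun w => ∃ k ≤ n, v * n ≤ Zd.euclidNorm (traj w k)) ⊆
      ((Ax ∪ Anx ∪ Ay ∪ Any) ∪ (Dp ∪ Dm ∪ Dq ∪ Dr)) ∪ ((T1 ∪ T2 ∪ T3 ∪ T4) ∪ (T5 ∪ T6 ∪ T7 ∪ T8)) := by
    intro w hw
    rw [mem_filter] at hw
    obtain ⟨hws, k, hk, hkv⟩ := hw
    have hvn : 0 ≤ v * n := by positivity
    simp only [mem_union, hAx, hAnx, hAy, hAny, hDp, hDm, hDq, hDr, hT1, hT2, hT3, hT4, hT5, hT6, hT7, hT8,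
      hf21, mem_filter, negX, negY, negXY, rotYX, rotNegYX, Matrix.cons_val_zero, Matrix.cons_val_one]
    rcases exists_dir16_ge_of_euclidNorm_ge hvn hkv with
      ((h0 | h0 | h0 | h0) | (h0 | h0 | h0 | h0)) | ((h0 | h0 | h0 | h0) | (h0 | h0 | h0 | h0))
    · exact Or.inl (Or.inl (Or.inl (Or.inl (Or.inl ⟨hws, k, hk, Int.ceil_le.2 h0⟩))))
    · exact Or.inl (Or.inl (Or.inl (Or.inl (Or.inr ⟨hws, k, hk, Int.ceil_le.2 (by push_cast; exact h0)⟩))))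
    · exact Or.inl (Or.inl (Or.inl (Or.inr ⟨hws, k, hk, Int.ceil_le.2 h0⟩)))
    · exact Or.inl (Or.inl (Or.inr ⟨hws, k, hk, Int.ceil_le.2 (by push_cast; exact h0)⟩))
    · exact Or.inl (Or.inr (Or.inl (Or.inl (Or.inl ⟨hws, k, hk, Int.ceil_le.2 (by push_cast; exact h0)⟩))))
    · exact Or.inl (Or.inr (Or.inl (Or.inl (Or.inr ⟨hws, k, hk, Int.ceil_le.2 (by push_cast; linarith)⟩))))
    · exact Or.inl (Or.inr (Or.inl (Or.inr ⟨hws, k, hk, Int.ceil_le.2 (by push_cast; linarith)⟩)))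
    · exact Or.inl (Or.inr (Or.inr ⟨hws, k, hk, Int.ceil_le.2 (by push_cast; linarith)⟩))
    · exact Or.inr (Or.inl (Or.inl (Or.inl (Or.inl ⟨hws, k, hk, Int.ceil_le.2 (by push_cast; linarith)⟩))))
    · exact Or.inr (Or.inl (Or.inl (Or.inl (Or.inr ⟨hws, k, hk, Int.ceil_le.2 (by push_cast; linarith)⟩))))
    · exact Or.inr (Or.inl (Or.inl (Or.inr ⟨hws, k, hk, Int.ceil_le.2 (by push_cast; linarith)⟩)))
    · exact Or.inr (Or.inl (Or.inr ⟨hws, k, hk, Int.ceil_le.2 (by push_cast; linarith)⟩))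
    · exact Or.inr (Or.inr (Or.inl (Or.inl (Or.inl ⟨hws, k, hk, Int.ceil_le.2 (by push_cast; linarith)⟩))))
    · exact Or.inr (Or.inr (Or.inl (Or.inl (Or.inr ⟨hws, k, hk, Int.ceil_le.2 (by push_cast; linarith)⟩))))
    · exact Or.inr (Or.inr (Or.inl (Or.inr ⟨hws, k, hk, Int.ceil_le.2 (by push_cast; linarith)⟩)))
    · exact Or.inr (Or.inr (Or.inr ⟨hws, k, hk, Int.ceil_le.2 (by push_cast; linarith)⟩))
  obtain ⟨n0, n1, n2, n3⟩ := negX_spec'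
  obtain ⟨r0, r1, r2, r3⟩ := rotYX_spec'
  obtain ⟨s0, s1, s2, s3⟩ := rotNegYX_spec'
  obtain ⟨y0, y1, y2, y3⟩ := negY_spec
  obtain ⟨z0, z1, z2, z3⟩ := negXY_spec
  have h1 : Anx.card ≤ Ax.card := card_dirEvent_le _ negX n0 n1 n2 n3 (refl_injective' 2) (fun z => z 0) n ma
  have h2 : Ay.card ≤ Ax.card := card_dirEvent_le _ rotYX r0 r1 r2 r3 (rot_injective' 3) (fun z => z 0) n ma
  have h3 : Any.card ≤ Ax.card := card_dirEvent_le _ rotNegYX s0 s1 s2 s3 (rot_injective' 1) (fun z => z 0) n ma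
  have h4 : Dm.card ≤ Dp.card :=
    card_dirEvent_le _ negXY z0 z1 z2 z3 (rot_injective' 2) (fun z => z 0 + z 1) n md
  have h5 : Dq.card ≤ Dp.card :=
    card_dirEvent_le _ negY y0 y1 y2 y3 (refl_injective' 0) (fun z => z 0 + z 1) n md
  have h6 : Dr.card ≤ Dp.card :=
    card_dirEvent_le _ negX n0 n1 n2 n3 (refl_injective' 2) (fun z => z 0 + z 1) n md
  have t2 : T2.card ≤ T1.card := card_dirEvent_le _ negXY z0 z1 z2 z3 (rot_injective' 2) f21 n mt
  have t3 : T3.card ≤ T1.card := card_dirEvent_le _ negY y0 y1 y2 y3 (refl_injective' 0) f21 n mt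
  have t4 : T4.card ≤ T1.card := card_dirEvent_le _ negX n0 n1 n2 n3 (refl_injective' 2) f21 n mt
  have t7 : T7.card ≤ T1.card := card_dirEvent_le _ rotNegYX s0 s1 s2 s3 (rot_injective' 1) f21 n mt
  have t8 : T8.card ≤ T1.card := card_dirEvent_le _ rotYX r0 r1 r2 r3 (rot_injective' 3) f21 n mt
  have t5 : T5.card ≤ T1.card :=
    le_trans (card_dirEvent_le _ negY y0 y1 y2 y3 (refl_injective' 0) (fun z => f21 (rotNegYX z)) n mt) t7
  have t6 : T6.card ≤ T1.card :=
    le_trans (card_dirEvent_le _ negY y0 y1 y2 y3 (refl_injective' 0) (fun z => f21 (rotYX z)) n mt) t8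
  have u0 := card_le_card hsub
  have u1 := card_union_le ((Ax ∪ Anx ∪ Ay ∪ Any) ∪ (Dp ∪ Dm ∪ Dq ∪ Dr)) ((T1 ∪ T2 ∪ T3 ∪ T4) ∪ (T5 ∪ T6 ∪ T7 ∪ T8))
  have u1a := card_union_le (Ax ∪ Anx ∪ Ay ∪ Any) (Dp ∪ Dm ∪ Dq ∪ Dr)
  have u1b := card_union_le (T1 ∪ T2 ∪ T3 ∪ T4) (T5 ∪ T6 ∪ T7 ∪ T8)
  have u2 := card_union_le (Ax ∪ Anx ∪ Ay) Any
  have u3 := card_union_le (Ax ∪ Anx) Ay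
  have u4 := card_union_le Ax Anx
  have u5 := card_union_le (Dp ∪ Dm ∪ Dq) Dr
  have u6 := card_union_le (Dp ∪ Dm) Dq
  have u7 := card_union_le Dp Dm
  have u8 := card_union_le (T1 ∪ T2 ∪ T3) T4
  have u9 := card_union_le (T1 ∪ T2) T3
  have u10 := card_union_le T1 T2
  have u11 := card_union_le (T5 ∪ T6 ∪ T7) T8
  have u12 := card_union_le (T5 ∪ T6) T7
  have u13 := card_union_le T5 T6
  omega

/-- The exponential rewriting of a tilted bound: `λ̄ⁿ s^m ≤ e^{-(c v log(1/s) − log(λ̄/μlo)) n} μloⁿ` for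
`m ≥ c·vn`, `0 < s ≤ 1`. [folklore] -/
private theorem tilted_exp_form {lam s μlo c v : ℝ} (hs0 : 0 < s) (hs1 : s ≤ 1) (hl0 : 0 < lam)
    (hμ0 : 0 < μlo) (n : ℕ) {m : ℤ} (hm : c * v * n ≤ m) :
    lam ^ n * s ^ m ≤ Real.exp (-((c * v * Real.log s⁻¹ - Real.log (lam / μlo)) * n)) * μlo ^ n := by
  have h1 : s ^ m ≤ s ^ (c * v * n : ℝ) := by
    rw [← Real.rpow_intCast]
    exact Real.rpow_le_rpow_of_exponent_ge hs0 hs1 hm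
  have hexp : lam ^ n * s ^ (c * v * n : ℝ) =
      Real.exp (-((c * v * Real.log s⁻¹ - Real.log (lam / μlo)) * n)) * μlo ^ n := by
    rw [Real.rpow_def_of_pos hs0, ← Real.exp_log (pow_pos hl0 n), ← Real.exp_log (pow_pos hμ0 n),
      ← Real.exp_add, ← Real.exp_add, Real.log_pow, Real.log_pow, Real.log_div hl0.ne' hμ0.ne', Real.log_inv]
    congr 1; ring
  rw [← hexp]; gcongr

/-- **Explicit sub-ballisticity via sixteen directions** (axis tilt `11/9`, diagonal tilt `7/6`, `(2,1)`-tilt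
`11/10`, memory 16, `μ ≥ 2.604`): for all `v ≥ 0` and `n`,
`#(maxDisplacementEvent 2 n v) ≤ 4(n+1)·2⁸²·(e^{-ε₁ n} + e^{-ε₂ n} + 2e^{-ε₃ n})·cₙ` with
`ε₁ = 0.9732 v log(11/9) − log(λ̄₁/2.604)`, `ε₂ = 1.3959 v log(7/6) − log(λ̄₂/2.604)`,
`ε₃ = 2.176 v log(11/10) − log(λ̄₃/2.604)`, `λ̄₁ = 278379899/(10⁶·99)`, `λ̄₂ = 118862805/(10⁶·42)`,
`λ̄₃ = 34181244/(1000·110²)`. [cite: DuminilCopinHammond2013, Thm 1.1] -/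
theorem card_maxDisplacementEvent_le_exp16 {v : ℝ} (hv : 0 ≤ v) (n : ℕ) :
    ((Zd.maxDisplacementEvent 2 n v).card : ℝ) ≤
      4 * (n + 1) * 2 ^ 82 *
        (Real.exp (-((9732 / 10000 * v * Real.log ((11 : ℝ) / 9) -
            Real.log ((278379899 : ℝ) / (1000000 * 11 * 9) / 2.604)) * n)) +
         Real.exp (-((13959 / 10000 * v * Real.log ((7 : ℝ) / 6) -
            Real.log ((118862805 : ℝ) / (1000000 * 7 * 6) / 2.604)) * n)) +
         2 * Real.exp (-((2176 / 1000 * v * Real.log ((11 : ℝ) / 10) -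
            Real.log ((34181244 : ℝ) / (1000 * (11 * 11) * (10 * 10)) / 2.604)) * n))) * Zd.count 2 n := by
  have hμ0 : (0 : ℝ) < 2.604 := by norm_num
  have hμ : (2.604 : ℝ) ≤ Zd.connectiveConstant 2 := le_connectiveConstant_2604
  set ma : ℤ := ⌈9732 / 10000 * (v * n)⌉ with hma
  set md : ℤ := ⌈13959 / 10000 * (v * n)⌉ with hmd
  set mt : ℤ := ⌈2176 / 1000 * (v * n)⌉ with hmt
  have h16 := card_maxDisplacementEvent_le_sixteen hv n
  have hA := card_maxEvent_le_of_checkW checkW_16_11_9 (by norm_num) (by norm_num) (by norm_num)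
    (by norm_num) n ma
  have hDg := card_maxEventDiag_le_of_checkD checkD_16_7_6 (by norm_num) (by norm_num) (by norm_num)
    (by norm_num) n md
  have hT := card_maxEvent21_le_of_checkT (a := 11) (b := 10) checkT_16_d21_11_10 (by norm_num) (by norm_num)
    (by norm_num) (by norm_num) n mt
  have hμn : (2.604 : ℝ) ^ n ≤ (Zd.count 2 n : ℝ) :=
    le_trans (pow_le_pow_left₀ hμ0.le hμ n) (Zd.pow_connectiveConstant_le_count 2 n)
  have e1 := tilted_exp_form (lam := ((278379899 : ℕ) : ℝ) / ((1000000 : ℕ) * (11 : ℕ) * (9 : ℕ)))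
    (s := ((9 : ℕ) : ℝ) / (11 : ℕ)) (c := 9732 / 10000) (v := v) (by norm_num) (by norm_num) (by norm_num) hμ0 n
    (m := ma) (by rw [hma, show (9732 : ℝ) / 10000 * v * n = 9732 / 10000 * (v * n) by ring]; exact Int.le_ceil _)
  have e2 := tilted_exp_form (lam := ((118862805 : ℕ) : ℝ) / ((1000000 : ℕ) * (7 : ℕ) * (6 : ℕ)))
    (s := ((6 : ℕ) : ℝ) / (7 : ℕ)) (c := 13959 / 10000) (v := v) (by norm_num) (by norm_num) (by norm_num) hμ0 n
    (m := md) (by rw [hmd, show (13959 : ℝ) / 10000 * v * n = 13959 / 10000 * (v * n) by ring]; exact Int.le_ceil _)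
  have e3 := tilted_exp_form (lam := ((34181244 : ℕ) : ℝ) / ((1000 : ℕ) * ((11 : ℕ) * (11 : ℕ)) * ((10 : ℕ) * (10 : ℕ))))
    (s := ((10 : ℕ) : ℝ) / (11 : ℕ)) (c := 2176 / 1000) (v := v) (by norm_num) (by norm_num) (by norm_num) hμ0 n
    (m := mt) (by rw [hmt, show (2176 : ℝ) / 1000 * v * n = 2176 / 1000 * (v * n) by ring]; exact Int.le_ceil _)
  have i1 : (((9 : ℕ) : ℝ) / (11 : ℕ))⁻¹ = (11 : ℝ) / 9 := by norm_num
  have i2 : (((6 : ℕ) : ℝ) / (7 : ℕ))⁻¹ = (7 : ℝ) / 6 := by norm_num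
  have i3 : (((10 : ℕ) : ℝ) / (11 : ℕ))⁻¹ = (11 : ℝ) / 10 := by norm_num
  have c1 : ((278379899 : ℕ) : ℝ) / ((1000000 : ℕ) * (11 : ℕ) * (9 : ℕ)) = (278379899 : ℝ) / (1000000 * 11 * 9) := by
    norm_num
  have c2 : ((118862805 : ℕ) : ℝ) / ((1000000 : ℕ) * (7 : ℕ) * (6 : ℕ)) = (118862805 : ℝ) / (1000000 * 7 * 6) := by
    norm_num
  have c3 : ((34181244 : ℕ) : ℝ) / ((1000 : ℕ) * ((11 : ℕ) * (11 : ℕ)) * ((10 : ℕ) * (10 : ℕ))) =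
      (34181244 : ℝ) / (1000 * (11 * 11) * (10 * 10)) := by norm_num
  rw [i1] at e1; rw [i2] at e2; rw [i3] at e3
  rw [c1] at e1 hA; rw [c2] at e2 hDg; rw [c3] at e3 hT
  set E1 := Real.exp (-((9732 / 10000 * v * Real.log ((11 : ℝ) / 9) -
    Real.log ((278379899 : ℝ) / (1000000 * 11 * 9) / 2.604)) * n))
  set E2 := Real.exp (-((13959 / 10000 * v * Real.log ((7 : ℝ) / 6) -
    Real.log ((118862805 : ℝ) / (1000000 * 7 * 6) / 2.604)) * n))
  set E3 := Real.exp (-((2176 / 1000 * v * Real.log ((11 : ℝ) / 10) -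
    Real.log ((34181244 : ℝ) / (1000 * (11 * 11) * (10 * 10)) / 2.604)) * n))
  have hcnt : (0 : ℝ) ≤ Zd.count 2 n := Nat.cast_nonneg _
  have hs9 : ((9 : ℕ) : ℝ) / (11 : ℕ) = (9 : ℝ) / 11 := by norm_num
  have hs6 : ((6 : ℕ) : ℝ) / (7 : ℕ) = (6 : ℝ) / 7 := by norm_num
  have hs10 : ((10 : ℕ) : ℝ) / (11 : ℕ) = (10 : ℝ) / 11 := by norm_num
  rw [hs9] at hA e1; rw [hs6] at hDg e2; rw [hs10] at hT e3
  calc ((Zd.maxDisplacementEvent 2 n v).card : ℝ)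
      ≤ 4 * (((sawWords n).filter fun w => ∃ k ≤ n, ma ≤ traj w k 0).card : ℝ) +
        4 * (((sawWords n).filter fun w => ∃ k ≤ n, md ≤ traj w k 0 + traj w k 1).card : ℝ) +
        8 * (((sawWords n).filter fun w => ∃ k ≤ n, mt ≤ 2 * traj w k 0 + traj w k 1).card : ℝ) := by
          exact_mod_cast h16
    _ ≤ 4 * ((n + 1) * 2 ^ 82 * ((278379899 : ℝ) / (1000000 * 11 * 9)) ^ n * ((9 : ℝ) / 11) ^ ma) +
        4 * ((n + 1) * 2 ^ 82 * ((118862805 : ℝ) / (1000000 * 7 * 6)) ^ n * ((6 : ℝ) / 7) ^ md) +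
        8 * ((n + 1) * 2 ^ 82 * ((34181244 : ℝ) / (1000 * (11 * 11) * (10 * 10))) ^ n * ((10 : ℝ) / 11) ^ mt) := by
          gcongr
    _ = 4 * (n + 1) * 2 ^ 82 * ((((278379899 : ℝ) / (1000000 * 11 * 9)) ^ n * ((9 : ℝ) / 11) ^ ma) +
        (((118862805 : ℝ) / (1000000 * 7 * 6)) ^ n * ((6 : ℝ) / 7) ^ md) +
        2 * (((34181244 : ℝ) / (1000 * (11 * 11) * (10 * 10))) ^ n * ((10 : ℝ) / 11) ^ mt)) := by ring
    _ ≤ 4 * (n + 1) * 2 ^ 82 * (E1 * (2.604 : ℝ) ^ n + E2 * (2.604 : ℝ) ^ n + 2 * (E3 * (2.604 : ℝ) ^ n)) := by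
          gcongr
    _ = 4 * (n + 1) * 2 ^ 82 * (E1 + E2 + 2 * E3) * (2.604 : ℝ) ^ n := by ring
    _ ≤ 4 * (n + 1) * 2 ^ 82 * (E1 + E2 + 2 * E3) * Zd.count 2 n := by
          have : 0 ≤ 4 * ((n : ℝ) + 1) * 2 ^ 82 * (E1 + E2 + 2 * E3) := by positivity
          exact mul_le_mul_of_nonneg_left hμn this

/-! ### The printed shape above the sixteen-direction threshold -/

/-- Absorbing the polynomial prefactor, three rates: `4(n+1)·2⁸²·(e^{-ε₁n} + e^{-ε₂n} + 2e^{-ε₃n}) ≤ e^{-εn}`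
for `n ≥ n₀` (`ε = min(ε₁,ε₂,ε₃)/2`, `n₀ = ⌈2⁸⁹/ε²⌉ + 1`). [folklore] -/
private theorem absorb_prefactor3 {ε₁ ε₂ ε₃ : ℝ} (h₁ : 0 < ε₁) (h₂ : 0 < ε₂) (h₃ : 0 < ε₃) :
    ∃ ε : ℝ, 0 < ε ∧ ∃ n₀ : ℕ, ∀ n : ℕ, n₀ ≤ n →
      4 * ((n : ℝ) + 1) * 2 ^ 82 * (Real.exp (-(ε₁ * n)) + Real.exp (-(ε₂ * n)) + 2 * Real.exp (-(ε₃ * n))) ≤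
        Real.exp (-(ε * n)) := by
  set e : ℝ := min (min ε₁ ε₂) ε₃ / 2 with he
  have hmin : 0 < min (min ε₁ ε₂) ε₃ := lt_min (lt_min h₁ h₂) h₃
  have he0 : 0 < e := by rw [he]; exact div_pos hmin two_pos
  have he1 : 2 * e ≤ ε₁ := by rw [he]; linarith [min_le_left (min ε₁ ε₂) ε₃, min_le_left ε₁ ε₂]
  have he2 : 2 * e ≤ ε₂ := by rw [he]; linarith [min_le_left (min ε₁ ε₂) ε₃, min_le_right ε₁ ε₂]
  have he3 : 2 * e ≤ ε₃ := by rw [he]; linarith [min_le_right (min ε₁ ε₂) ε₃]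
  refine ⟨e, he0, Nat.ceil (2 ^ 89 / e ^ 2) + 1, fun n hn => ?_⟩
  have hn1 : (1 : ℝ) ≤ n := by exact_mod_cast (show 1 ≤ n by omega)
  have hn0 : (0 : ℝ) ≤ n := by positivity
  have hnbig : 2 ^ 89 / e ^ 2 ≤ (n : ℝ) := by
    have := Nat.le_ceil (2 ^ 89 / e ^ 2)
    have h' : ((Nat.ceil (2 ^ 89 / e ^ 2) : ℕ) : ℝ) + 1 ≤ n := by exact_mod_cast hn
    linarith
  have hx1 : Real.exp (-(ε₁ * n)) ≤ Real.exp (-(2 * e * n)) := Real.exp_le_exp.2 (by nlinarith)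
  have hx2 : Real.exp (-(ε₂ * n)) ≤ Real.exp (-(2 * e * n)) := Real.exp_le_exp.2 (by nlinarith)
  have hx3 : Real.exp (-(ε₃ * n)) ≤ Real.exp (-(2 * e * n)) := Real.exp_le_exp.2 (by nlinarith)
  have hq : (e * n) ^ 2 / 2 ≤ Real.exp (e * n) := by
    have := Real.quadratic_le_exp_of_nonneg (show 0 ≤ e * n by positivity)
    nlinarith [Real.exp_nonneg (e * n), show 0 ≤ e * n by positivity]
  have hpoly : 2 ^ 86 * ((n : ℝ) + 1) ≤ (e * n) ^ 2 / 2 := by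
    have he2pos : 0 < e ^ 2 := by positivity
    have h1 : 2 ^ 89 ≤ e ^ 2 * n := by
      have := mul_le_mul_of_nonneg_left hnbig he2pos.le
      rwa [mul_div_cancel₀ _ he2pos.ne'] at this
    nlinarith
  have hfin : 2 ^ 86 * ((n : ℝ) + 1) * Real.exp (-(2 * e * n)) ≤ Real.exp (-(e * n)) := by
    have hexp : Real.exp (-(2 * e * n)) = Real.exp (-(e * n)) * (Real.exp (e * n))⁻¹ := by
      rw [← Real.exp_neg, ← Real.exp_add]; congr 1; ring
    rw [hexp, ← mul_assoc]
    have hpos : 0 < Real.exp (e * n) := Real.exp_pos _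
    rw [mul_inv_le_iff₀ hpos]
    calc 2 ^ 86 * ((n : ℝ) + 1) * Real.exp (-(e * n)) ≤ Real.exp (e * n) * Real.exp (-(e * n)) := by
          gcongr; exact le_trans hpoly hq
      _ = Real.exp (-(e * n)) * Real.exp (e * n) := mul_comm _ _
  calc 4 * ((n : ℝ) + 1) * 2 ^ 82 * (Real.exp (-(ε₁ * n)) + Real.exp (-(ε₂ * n)) + 2 * Real.exp (-(ε₃ * n)))
      ≤ 4 * ((n : ℝ) + 1) * 2 ^ 82 *
          (Real.exp (-(2 * e * n)) + Real.exp (-(2 * e * n)) + 2 * Real.exp (-(2 * e * n))) := by gcongr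
    _ = 2 ^ 86 * ((n : ℝ) + 1) * Real.exp (-(2 * e * n)) := by ring
    _ ≤ Real.exp (-(e * n)) := hfin

/-- **The certified threshold speed of the sixteen-direction scheme**:
`v₁₆ = max( log(λ̄₁/2.604)/(0.9732·log(11/9)), log(λ̄₂/2.604)/(1.3959·log(7/6)), log(λ̄₃/2.604)/(2.176·log(11/10)) )
= 0.3933…`. [cite: DuminilCopinHammond2013, Thm 1.1] -/
noncomputable def speedThreshold16 : ℝ :=
  max (max (Real.log ((278379899 : ℝ) / (1000000 * 11 * 9) / 2.604) / (9732 / 10000 * Real.log ((11 : ℝ) / 9)))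
      (Real.log ((118862805 : ℝ) / (1000000 * 7 * 6) / 2.604) / (13959 / 10000 * Real.log ((7 : ℝ) / 6))))
    (Real.log ((34181244 : ℝ) / (1000 * (11 * 11) * (10 * 10)) / 2.604) / (2176 / 1000 * Real.log ((11 : ℝ) / 10)))

/-- **Duminil-Copin–Hammond, Theorem 1.1, for `ℤ²` and every speed `v > v₁₆ = 0.3933…`, printed shape**:
there are `ε > 0` and `n₀` with `#{γ ∈ SAW_n : max_k ‖γ_k‖ ≥ vn}/cₙ ≤ e^{-εn}` for all `n ≥ n₀`.
[cite: DuminilCopinHammond2013, Thm 1.1] -/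
theorem dch_thm11_two_explicit16 {v : ℝ} (hv : speedThreshold16 < v) :
    ∃ ε : ℝ, 0 < ε ∧ ∃ n₀ : ℕ, ∀ n : ℕ, n₀ ≤ n →
      ((Zd.maxDisplacementEvent 2 n v).card : ℝ) / (Zd.count 2 n : ℝ) ≤ Real.exp (-(ε * n)) := by
  have hl1 : 0 < Real.log ((11 : ℝ) / 9) := Real.log_pos (by norm_num)
  have hl2 : 0 < Real.log ((7 : ℝ) / 6) := Real.log_pos (by norm_num)
  have hl3 : 0 < Real.log ((11 : ℝ) / 10) := Real.log_pos (by norm_num)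
  have hv1 : Real.log ((278379899 : ℝ) / (1000000 * 11 * 9) / 2.604) / (9732 / 10000 * Real.log ((11 : ℝ) / 9)) < v :=
    lt_of_le_of_lt (le_trans (le_max_left _ _) (le_max_left _ _)) hv
  have hv2 : Real.log ((118862805 : ℝ) / (1000000 * 7 * 6) / 2.604) / (13959 / 10000 * Real.log ((7 : ℝ) / 6)) < v :=
    lt_of_le_of_lt (le_trans (le_max_right _ _) (le_max_left _ _)) hv
  have hv3 : Real.log ((34181244 : ℝ) / (1000 * (11 * 11) * (10 * 10)) / 2.604) /
      (2176 / 1000 * Real.log ((11 : ℝ) / 10)) < v := lt_of_le_of_lt (le_max_right _ _) hv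
  have hv0 : 0 ≤ v := by
    have : 0 ≤ Real.log ((278379899 : ℝ) / (1000000 * 11 * 9) / 2.604) / (9732 / 10000 * Real.log ((11 : ℝ) / 9)) :=
      div_nonneg (Real.log_nonneg (by norm_num)) (by positivity)
    linarith
  set ε₁ : ℝ := 9732 / 10000 * v * Real.log ((11 : ℝ) / 9) -
    Real.log ((278379899 : ℝ) / (1000000 * 11 * 9) / 2.604) with hε₁
  set ε₂ : ℝ := 13959 / 10000 * v * Real.log ((7 : ℝ) / 6) -
    Real.log ((118862805 : ℝ) / (1000000 * 7 * 6) / 2.604) with hε₂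
  set ε₃ : ℝ := 2176 / 1000 * v * Real.log ((11 : ℝ) / 10) -
    Real.log ((34181244 : ℝ) / (1000 * (11 * 11) * (10 * 10)) / 2.604) with hε₃
  have h1 : 0 < ε₁ := by rw [hε₁]; rw [div_lt_iff₀ (by positivity)] at hv1; linarith
  have h2 : 0 < ε₂ := by rw [hε₂]; rw [div_lt_iff₀ (by positivity)] at hv2; linarith
  have h3 : 0 < ε₃ := by rw [hε₃]; rw [div_lt_iff₀ (by positivity)] at hv3; linarith
  obtain ⟨ε, hε, n₀, hn₀⟩ := absorb_prefactor3 h1 h2 h3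
  refine ⟨ε, hε, n₀ + 1, fun n hn => ?_⟩
  have hc : (0 : ℝ) < Zd.count 2 n := by
    have := Zd.pow_connectiveConstant_le_count 2 n
    exact lt_of_lt_of_le (pow_pos (Zd.connectiveConstant_pos 2) n) this
  rw [div_le_iff₀ hc]
  have hmain := card_maxDisplacementEvent_le_exp16 hv0 n
  have hab := hn₀ n (by omega)
  calc ((Zd.maxDisplacementEvent 2 n v).card : ℝ)
      ≤ 4 * (n + 1) * 2 ^ 82 * (Real.exp (-(ε₁ * n)) + Real.exp (-(ε₂ * n)) + 2 * Real.exp (-(ε₃ * n))) *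
          Zd.count 2 n := by simpa [hε₁, hε₂, hε₃] using hmain
    _ ≤ Real.exp (-(ε * n)) * Zd.count 2 n := by gcongr

/-- Series upper bound `-log(1-x) ≤ ∑_{i<N} x^{i+1}/(i+1) + x^{N+1}/(1-x)` (`0 ≤ x < 1`). [folklore] -/
private theorem neg_log_one_sub_le' {x : ℝ} (hx0 : 0 ≤ x) (hx1 : x < 1) (N : ℕ) :
    -Real.log (1 - x) ≤ (∑ i ∈ Finset.range N, x ^ (i + 1) / (i + 1)) + x ^ (N + 1) / (1 - x) := by
  have h := Real.abs_log_sub_add_sum_range_le (show |x| < 1 by rwa [abs_of_nonneg hx0]) N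
  rw [abs_of_nonneg hx0] at h
  linarith [(abs_le.1 h).1]

/-- Series lower bound `∑_{i<N} x^{i+1}/(i+1) - x^{N+1}/(1-x) ≤ -log(1-x)` (`0 ≤ x < 1`). [folklore] -/
private theorem le_neg_log_one_sub'' {x : ℝ} (hx0 : 0 ≤ x) (hx1 : x < 1) (N : ℕ) :
    (∑ i ∈ Finset.range N, x ^ (i + 1) / (i + 1)) - x ^ (N + 1) / (1 - x) ≤ -Real.log (1 - x) := by
  have h := Real.abs_log_sub_add_sum_range_le (show |x| < 1 by rwa [abs_of_nonneg hx0]) N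
  rw [abs_of_nonneg hx0] at h
  linarith [(abs_le.1 h).2]

/-- `log R ≤ ∑_{i<N} (1-1/R)^{i+1}/(i+1) + (1-1/R)^{N+1}·R` for `R ≥ 1`. [folklore] -/
private theorem log_le_series' {R : ℝ} (hR : 1 ≤ R) (N : ℕ) :
    Real.log R ≤ (∑ i ∈ Finset.range N, (1 - R⁻¹) ^ (i + 1) / (i + 1)) + (1 - R⁻¹) ^ (N + 1) * R := by
  have hR0 : 0 < R := by linarith
  have hx0 : 0 ≤ 1 - R⁻¹ := by rw [sub_nonneg]; exact inv_le_one_of_one_le₀ hR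
  have hx1 : 1 - R⁻¹ < 1 := by have := inv_pos.2 hR0; linarith
  have h := neg_log_one_sub_le' hx0 hx1 N
  rwa [show (1 : ℝ) - (1 - R⁻¹) = R⁻¹ by ring, Real.log_inv, neg_neg, div_inv_eq_mul] at h

/-- `log(11/9) > 0.20067` (`= 0.2006707`). [folklore] -/
private theorem log_eleven_div_nine_gt' : (0.20067 : ℝ) < Real.log ((11 : ℝ) / 9) := by
  have h := le_neg_log_one_sub'' (x := 2 / 11) (by norm_num) (by norm_num) 8
  rw [show (1 : ℝ) - 2 / 11 = ((11 : ℝ) / 9)⁻¹ by norm_num, Real.log_inv, neg_neg] at h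
  refine lt_of_lt_of_le ?_ h
  norm_num [Finset.sum_range_succ]

/-- `log(7/6) > 0.15414` (`= 0.154150…`). [folklore] -/
private theorem log_seven_div_six_gt' : (0.15414 : ℝ) < Real.log ((7 : ℝ) / 6) := by
  have h := le_neg_log_one_sub'' (x := 1 / 7) (by norm_num) (by norm_num) 6
  rw [show (1 : ℝ) - 1 / 7 = ((7 : ℝ) / 6)⁻¹ by norm_num, Real.log_inv, neg_neg] at h
  refine lt_of_lt_of_le ?_ h
  norm_num [Finset.sum_range_succ]

/-- `log(11/10) > 0.0953` (`= 0.095310…`). [folklore] -/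
private theorem log_eleven_div_ten_gt : (0.0953 : ℝ) < Real.log ((11 : ℝ) / 10) := by
  have h := le_neg_log_one_sub'' (x := 1 / 11) (by norm_num) (by norm_num) 5
  rw [show (1 : ℝ) - 1 / 11 = ((11 : ℝ) / 10)⁻¹ by norm_num, Real.log_inv, neg_neg] at h
  refine lt_of_lt_of_le ?_ h
  norm_num [Finset.sum_range_succ]

/-- **`speedThreshold16 < 0.3935`** (its value is `0.39335…`; the three direction classes give `0.39335`,
`0.38689`, `0.39260`): Theorem 1.1 holds with an explicit rate for every `v ≥ 0.3935`.
[cite: DuminilCopinHammond2013, Thm 1.1] -/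
theorem speedThreshold16_lt : speedThreshold16 < 0.3935 := by
  have hl1 := log_eleven_div_nine_gt'
  have hl2 := log_seven_div_six_gt'
  have hl3 := log_eleven_div_ten_gt
  have hp1 : (0 : ℝ) < 9732 / 10000 * Real.log ((11 : ℝ) / 9) := by linarith
  have hp2 : (0 : ℝ) < 13959 / 10000 * Real.log ((7 : ℝ) / 6) := by linarith
  have hp3 : (0 : ℝ) < 2176 / 1000 * Real.log ((11 : ℝ) / 10) := by linarith
  refine max_lt (max_lt ?_ ?_) ?_
  · rw [div_lt_iff₀ hp1]
    have hu := log_le_series' (R := (278379899 : ℝ) / (1000000 * 11 * 9) / 2.604) (by norm_num) 6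
    have hu' : Real.log ((278379899 : ℝ) / (1000000 * 11 * 9) / 2.604) ≤ 0.07682 :=
      le_trans hu (by norm_num [Finset.sum_range_succ])
    have hc : (0.07682 : ℝ) < 0.3935 * (9732 / 10000 * 0.20067) := by norm_num
    nlinarith
  · rw [div_lt_iff₀ hp2]
    have hu := log_le_series' (R := (118862805 : ℝ) / (1000000 * 7 * 6) / 2.604) (by norm_num) 4
    have hu' : Real.log ((118862805 : ℝ) / (1000000 * 7 * 6) / 2.604) ≤ 0.083255 :=
      le_trans hu (by norm_num [Finset.sum_range_succ])
    have hc : (0.083255 : ℝ) < 0.3935 * (13959 / 10000 * 0.15414) := by norm_num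
    nlinarith
  · rw [div_lt_iff₀ hp3]
    have hu := log_le_series' (R := (34181244 : ℝ) / (1000 * (11 * 11) * (10 * 10)) / 2.604) (by norm_num) 5
    have hu' : Real.log ((34181244 : ℝ) / (1000 * (11 * 11) * (10 * 10)) / 2.604) ≤ 0.08144 :=
      le_trans hu (by norm_num [Finset.sum_range_succ])
    have hc : (0.08144 : ℝ) < 0.3935 * (2176 / 1000 * 0.0953) := by norm_num
    nlinarith

end Literature.Probability.RandomPlanarGeometry.SAW
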